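import Summits.CriticalPhenomena.SAWScalingLimit.Theses.SAWLeftRightFKG
import Summits.CriticalPhenomena.SAWScalingLimit.Theorems.FKGToTraversalBound.Negative.DeepEndpointGap
import Summits.CriticalPhenomena.SAWScalingLimit.Theorems.SAWLeftRightFKGFKGToTraversalBoundGreenDecomposition
import Summits.CriticalPhenomena.SAWScalingLimit.Theorems.SAWLeftRightFKGFKGToTraversalBoundTreeTailBound
import Summits.CriticalPhenomena.SAWScalingLimit.Theorems.SAWLeftRightFKGFKGToTraversalBoundSweep
import Summits.CriticalPhenomena.SAWScalingLimit.Theorems.SAWLeftRightFKGFKGToTraversalBoundSlitPresentation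
import Summits.CriticalPhenomena.SAWScalingLimit.Theorems.SAWLeftRightFKGFKGToTraversalBoundRWCollarOfKilled2
import Summits.CriticalPhenomena.SAWScalingLimit.Theorems.SAWLeftRightFKGFKGToTraversalBoundKilledWalkCollarBoundOfKS
import Literature.Probability.LatticeModels.DirichletGreenFunction
import Literature.Probability.LatticeModels.HoleFreePotential

/-!
# Line `excursion-domination` — skeleton for crux `FKGToTraversalBound` (stmt-CriticalPhenomena-1878)

Crux (route `SAWLeftRightFKG`, rank 3): `FKGToTraversalBound := LeftRightFKG → SAWTraversalBound`
(`Iff.rfl`, Disproof §1 `iff_imp`): left–right positive association (PA) of the critical square-lattice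
SAW chord measure in every r2 domain `Ω = {wind(C,·) ≠ 0}` between boundary-adjacent endpoints should
give the Aizenman–Burchard hypothesis (H1) (shell-dependent threshold) for every Dobrushin domain and
every endpoint approximation.  By Disproof F1 (`mono_hyp`) every proof is `PA → P` and `P → (H1)` for a
consequence `P` of PA; here `P` = (qualitative) EXCURSION DOMINATION.

Idea (card `Ideas/excursion-domination.md`, triage r1-1/2/3: pass ×3, "could not break"): compare the
chord with the KILLED RANDOM WALK, not with itself.  `ED(C)`: in every r2 domain, for every finite set
`H` of sites whose avoidance event is ONE-SIDED (down- or up-closed in the route's left–right order `≼`),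
`P_SAW(avoid H) ≥ (G_{Λ∖H}(a,b)/G_Λ(a,b))^C` — the lattice shadow of the restriction exponents
`5/8 ≤ 1` (`P_{SLE_{8/3}}(avoid A) = Φ'_A^{5/8} ≥ Φ'_A = P_exc(avoid A)`, tree
`IsRestrictionMeasure.measure_avoid_excHull`).  Both sides are exact multiplicative cocycles in `H`,
and the right-hand side is discrete potential theory, where rough walls are harmless.

How the line reaches (H1) — the FIVE registered stubs (lead's reshape r1, 2026-08-16) and the proved glue:

* RESHAPE NOTE (lead prover-line-stmt-CriticalPhenomena-1878-0).  The card's transfer `ExcursionDominationIneq`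
  ("∃ C ≥ 1, P_SAW(avoid H) ≥ P_RWexc(avoid H)^C for every one-sided H") is FALSE AS TYPED: on the family "far end
  of a width-w dead-end corridor, length ℓ → ∞" the x_c-SAW penetration rate per row c_SAW(w) (growth rate of
  x_c-weighted self-avoiding polygons in a width-w strip, Motzkin-state transfer matrix) drops BELOW the killed
  walk's two-way rate c_RW(w) = 2 acosh(2 − cos(π/(w+1))) at w = 13 (gap +3.5e-5 at w = 12, −3.7e-5 at w = 13;
  SAW extrapolation length 2×0.011 sites; evidence `Lines/excursion-domination.stub1-false.md`,
  `work/exp/strip_sap_tm.c`), so P_SAW(hit)/P_RW(hit) → ∞ along it and no exponent C works.  What the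
  composition CONSUMES is only `SAWCollarBound`, for which that family is harmless (both avoidances → 1).  The
  qualitative ∀H form (reshape r1) dies as well, on K ≈ ln2/q_RW side-by-side corridors (cocycles on both sides);
  what survives is COLLARED domination `RWCollarBound → SAWCollarBound` (reshape r3), exactly what
  `sawCollarBound_of` needs.  PA is consumed there (stub 1, HARDEST, open, the lead's).  Small-scale evidence for
  domination itself: over all 1.19 M (S, a, b, y) instances inside 4×4 / 5×4 with one-sided y,
  P_SAW(avoid y) ≥ P_RW(avoid y) − 0.04 (lead, `work/exp/qualdom_scan.py`).
* `stub_sawDomination : LeftRightFKG → CollaredDomination` (`CollaredDomination := RWCollarBound → SAWCollarBound`) —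
  HARDEST (open; the card's comparison idea in the only form its falsifiers leave standing: reshape r1 replaced the
  power law by the qualitative ∀H form, reshape r3 restricts it to collared dead ends after the K-corridor family
  killed the ∀H form too — see `CollaredDomination`'s docstring).
* `stub_greenDecomposition : GreenDecomposition` — PROVABLE NOW (M): the first-entrance decomposition of the
  Dirichlet Green function across a removed set, `G_Λ(a,b) = G_{Λ∖H}(a,b) + Σ_{z∈H} H_{Λ∖H}(a,z) G_Λ(z,b)` for
  `a ∉ H` (Green's representation formula `green_representation` in `Λ ∖ H` applied to `G_Λ(·,b)`, the Poisson
  equation `neg_latticeLaplacianZd_dirichletGreen` and symmetry `dirichletGreen_comm`); it is the matrix form of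
  the strong Markov property that both the collar bound and any domination argument use.
* `stub_rwCollarBound : GreenDecomposition → RWCollarBound` — the ε-source: behind a lattice COLLAR of modulus
  `M` the killed-walk excursion from `a` to `b` avoids the dead end with probability `≥ η` (Kemppainen–Smirnov
  2017 Prop. 4.11 / Thm. 4.12 grade; tree: `weakBeurling_of_cutPath`, `latticeHM_compl_sqBox_le_of_cutPath`,
  `le_add_mul_latticeHM`, `harnack_one_scale`, `dirichletGreen` API).  Size L.
* `sawCollarBound_of` (PROVED here, one line after r3): CollaredDomination + RW collar bound ⇒ `SAWCollarBound` (the uniform pocket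
  lemma every line of this crux needs, rough walls on the harmonic-measure side).
* `stub_shellIteration : SAWCollarBound → GoodShellTight` — the Kemppainen–Smirnov iteration on the lattice for
  every endpoint approximation AT ITS PRESENTABLE MESHES (exact domain Markov property, one-sidedness of dead ends
  behind avoidable monochromatic components, nesting, KS17 Lemma 3.6 / Prop. 3.5 with a `δ`-uniform forced count)
  giving PER-SHELL TIGHTNESS of the traversal counts.  XL but charted.
* `stub_residualShells : ResidualShellTight` — per-shell tightness for the endpoint approximations that are NOT
  eventually presentable (deep endpoints, Disproof F3; rough discretisations F3(c)).  NOT this line's mechanism;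
  statement-repair residue shared by every line of this crux (route-level repair R1).
* `traversalBound_of_shellTight` (PROVED here, triage X2; the same reduction is in the tree as
  `Theorems.sawTraversalBound_of_shellCountTight`): per-shell tightness at modulus `≥ M` ⇒ `SAWTraversalBound`
  with `K = M³`, `λ = 3`, and `FKGToTraversalBound_of` concludes the crux BY NAME (case split Good / not Good).

`sorry` occurs only in the `stub_*` theorems.  RESHAPE r5 (lead c1, 2026-08-16): `stub_greenDecomposition` is
wired to its landed proof (p84645); STUB 4 is split at the skeleton level into the def-free, worker-sized plumbing
stubs `stub_treeTailBound` (adapted KS counting), `stub_sweep` (closure of the r2 boundary class under killing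
sites, combinatorial winding), `stub_slitPresentation` (sweep ⇒ presentation of the slit domain, incl. the
largest-component convention of `meshDomain`) and the geometric core `stub_shellIterationCore`; seven registered
stubs in all (`stub_sawDomination`, `stub_rwCollarBound`, `stub_treeTailBound`, `stub_sweep`,
`stub_slitPresentation`, `stub_shellIterationCore`, `stub_residualShells`).  RESHAPE r6 (lead c1, same day): wave 1 LANDED
`stub_treeTailBound` (p99860) and `stub_sweep` (p100023), both wired below; `stub_rwCollarBound` is split into the killed-walk
kernel `stub_killedWalkCollarBound` (hole-free `Λ`; blocked on a Chelkak-2016-type uniformisation) and worker W4's reduction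
`stub_rwCollarOfKilled` (hole-freeness of r2 lattice domains + positivity of `G_Λ(a,b)`) — LANDED p102608 and RE-LANDED
importably as p106714 (lead c2, reshape r7: sub-namespace `…KilledReduction`; wired below), and
`stub_slitPresentation` LANDED p102570 and wired.  Open `sorry`s after r8 (lead c2, 2026-08-16; r7 = r6 with stub 3b wired to its re-landing p106714; r8 = the RW kernel
`stub_killedWalkCollarBound` CLOSED MODULO the named Literature fact `KemppainenSmirnov2017_rwDeadEndBound` — p109398, p111883,
p112619, p113575, p114323 + Literature def p113449): `stub_sawDomination` (engine; needs the ceiling critical bubble,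
`Cruxes/…/EngineNeedsBubble.lean`), `stub_ksDeadEndBound` (Literature debt: KS17 RW dead-end bound), `stub_shellIterationCore`
(lattice KS geometry), `stub_residualShells` (scope residue, route repair R1).
-/

noncomputable section

open MeasureTheory Filter Topology Set Metric
open scoped NNReal ENNReal
open Literature.Probability.LatticeModels
open Literature.Probability.RandomPlanarGeometry
open Literature.Probability.RandomPlanarGeometry.SAW
open Summit.CriticalPhenomena.SAWScalingLimit.Theses.SAWLeftRightFKG
open Summit.CriticalPhenomena.SAWScalingLimit.Theorems.FKGToTraversalBound.Negative (dom lrLE)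

namespace Summit.CriticalPhenomena.SAWScalingLimit.Cruxes.FKGToTraversalBound.ExcursionDomination

/-! ## Vocabulary of the line -/

section Vocabulary

variable {Ω : Set ℂ} {δ : ℝ} {a b : Site 2}

/-- The chords of `Ω_δ` from `a` to `b` that AVOID the set `H` of lattice sites. -/
def Avoid (H : Set (Site 2)) : Set (DomainSAW Ω δ a b) :=
  {γ | ∀ v ∈ γ.walk.support, v ∉ H}

end Vocabulary

/-- A set `S` of chords is ONE-SIDED for the relation `le` (the route's left–right order `≼`):
it is down-closed or up-closed.  For `S = Avoid H` this says `H` behaves like a hull attached to ONE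
of the two boundary arcs (lattice crosscut lemma); unions of same-side avoidances are again one-sided
(intersection of down-closed sets). -/
def OneSided {ι : Type*} (le : ι → ι → Prop) (S : Set ι) : Prop :=
  (∀ γ₁ γ₂, le γ₁ γ₂ → γ₂ ∈ S → γ₁ ∈ S) ∨ (∀ γ₁ γ₂, le γ₁ γ₂ → γ₁ ∈ S → γ₂ ∈ S)

/-- `u` and `v` are joined by a nearest-neighbour lattice path all of whose sites lie in `Λ` and
off `V` (reachability in the induced `ℤ²`-graph on `Λ ∖ V`; reflexive for `u ∈ Λ ∖ V`). -/
def JoinedOff (Λ V : Finset (Site 2)) (u v : Site 2) : Prop :=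
  ∃ p : (zdGraph 2).Walk u v, ∀ x ∈ p.support, x ∈ Λ ∧ x ∉ V

/-- **Collar structure** (lattice form of "the set `H` lies in a dead end behind an annulus of
modulus `R/r`", Kemppainen–Smirnov's avoidable quad with monochromatic sides, Def. 2.2 / Lemma 3.6):
there is a COLLAR `V ⊆ Λ` of sites whose mesh points lie in the closed annulus
`r ≤ |δx − z₀| ≤ R` such that, writing `Near` for the sites joined to `a` in `Λ ∖ V`,
* `b ∈ Near` (the collar is AVOIDABLE: it does not separate `a` from `b`),
* `H` misses `Near` and the collar (so `H` lies in the dead end `Far := Λ ∖ V ∖ Near`, or off `Λ`),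
* every `Λ`-edge leaving the collar towards `Near` crosses the INNER circle, and every edge leaving it towards a
  site joined to `H` off the collar crosses the OUTER circle — or the other way round (second disjunct); [reshape r4:
  the stub-4 worker showed that constraining EVERY non-Near neighbour (as first typed) makes the structure
  unsatisfiable at the iteration's observation times, when past-carved pockets hang off the near rim]
* and some NON-domain site lies within `r + δ` of the centre (Kemppainen–Smirnov's clause
  `∂B(z₀, r) ∩ ∂U_τ ≠ ∅`, Def. 2.2: the wall that makes Beurling's estimate bite; in an r2 domain every
  non-domain site is joined to infinity off the domain, `noFloatingHoles`).
In particular `V` is a union of connected components of `Λ ∩ annulus`, its lateral walls are killing,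
and every lattice path from `Far` to `Near` traverses the collar radially.  Several dead ends behind the
same annulus are ONE collar structure (take the union of their collars). -/
def IsCollaredOff (Λ : Finset (Site 2)) (a b : Site 2) (δ : ℝ) (z₀ : ℂ) (r R : ℝ)
    (H : Finset (Site 2)) : Prop :=
  ∃ V : Finset (Site 2), V ⊆ Λ ∧
    (∀ x ∈ V, r ≤ dist (meshPoint δ x) z₀ ∧ dist (meshPoint δ x) z₀ ≤ R) ∧
    JoinedOff Λ V a b ∧
    (∀ y, JoinedOff Λ V a y → y ∉ H) ∧ (∀ x ∈ V, x ∉ H) ∧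
    (∃ p : Site 2, p ∉ Λ ∧ dist (meshPoint δ p) z₀ ≤ r + δ) ∧
    ((∀ x ∈ V, ∀ y ∈ Λ, y ∉ V → (zdGraph 2).Adj x y →
        (JoinedOff Λ V a y → dist (meshPoint δ y) z₀ < r) ∧
        ((∃ h ∈ H, JoinedOff Λ V y h) → R < dist (meshPoint δ y) z₀)) ∨
     (∀ x ∈ V, ∀ y ∈ Λ, y ∉ V → (zdGraph 2).Adj x y →
        (JoinedOff Λ V a y → R < dist (meshPoint δ y) z₀) ∧
        ((∃ h ∈ H, JoinedOff Λ V y h) → dist (meshPoint δ y) z₀ < r)))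

/-! ## Statements of the line

All r2-side statements quantify over the binders of `LeftRightFKG` VERBATIM: mesh `δ > 0`, a closed
lattice walk `C` (the boundary; slits allowed), the domain `dom C δ = {z | wind(δ-polyline of C, z) ≠ 0}`
and endpoints `a, b` lattice-adjacent to vertices `a', b'` of `C`; `lrLE` is the route's order (both from
`Theorems/FKGToTraversalBound/Negative/DeepEndpointGap.lean`, `leftRightFKG_iff_PAClause : … := Iff.rfl`).
`Λ = meshDomain (dom C δ) δ` as a `Finset` through the finiteness binder `hΛ` (the domain is bounded).
-/

/-- **First-entrance decomposition of the Dirichlet Green function** (matrix form of the strong Markov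
property of the killed walk; Lawler 1991 §1.4–1.5): for finite `Λ, H ⊆ ℤ²` and `a ∉ H`,
`G_Λ(a,b) = G_{Λ∖H}(a,b) + Σ_{z ∈ H} H_{Λ∖H}(a,z) · G_Λ(z,b)` — the walk from `a` either reaches `b`
before entering `H` or enters `H` first at some `z` (Poisson kernel of `Λ ∖ H`) and then goes from `z` to `b`.
With `dirichletGreen_nonneg` / `poissonKernel_nonneg` it gives `0 ≤ G_{Λ∖H}(a,b) ≤ G_Λ(a,b)`.  Proof chart:
`green_representation` (`d = 2`) on `Λ ∖ H` for `F := G_Λ(·, b) = G_Λ(b, ·)` (`dirichletGreen_comm`), whose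
`-Δ` on `Λ` is `δ_b` (`neg_latticeLaplacianZd_dirichletGreen`) and which vanishes off `Λ`; terms with
`z ∈ H` not adjacent to `Λ ∖ H` or `z ∉ Λ` vanish on both sides.  Provable now (size M). -/
def GreenDecomposition : Prop :=
  ∀ (Λ H : Finset (Site 2)) (a b : Site 2), a ∉ H →
    dirichletGreen Λ a b = dirichletGreen (Λ \ H) a b +
      ∑ z ∈ H, poissonKernel (Λ \ H) a z * dirichletGreen Λ z b

/-- **Random-walk collar bound** (dead-end estimate for the killed walk; the line's ε-source).
There are `M > 1` and `η > 0` such that in every r2 domain, for every annulus `r ≤ |z − z₀| ≤ R` with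
`δ ≤ r` and `M r ≤ R` and every `H` collared off from `a, b` by it, the Green function does not drop
by more than the factor `η` when `H` is removed: `η G_Λ(a,b) ≤ G_{Λ∖H}(a,b)` (and `G_Λ(a,b) > 0`:
`a, b` are joined in `Λ`).  Equivalently the `a → b` excursion of the walk killed off `Λ` enters the
dead end behind a collar of modulus `M` with probability `≤ 1 - η`, uniformly in the roughness of the
walls.  Kemppainen–Smirnov 2017, Prop. 4.11 + proof of Thm. 4.12 (chordal LERW: the conditioned walk
reaches the far side of a dead-end boundary quad of extremal length `≥ L₀` with probability
`≤ 1 - ε₀/4`), transplanted from quads to round collars; ingredients in tree and PROVED: weak Beurling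
(`weakBeurling_of_cutPath`, `latticeHM_compl_sqBox_le_of_cutPath`; the cut path is `Near ∪ C ∪`
exterior, connected to infinity by `noFloatingHoles`), one-scale Harnack (`harnack_one_scale`),
`dirichletGreen` / `poissonKernel` / `green_representation`. -/
def RWCollarBound : Prop :=
  ∃ (M η : ℝ), 1 < M ∧ 0 < η ∧ ∀ (δ : ℝ) (c a b a' b' : Site 2) (C : (zdGraph 2).Walk c c),
    0 < δ → a' ∈ C.support → b' ∈ C.support → (zdGraph 2).Adj a a' → (zdGraph 2).Adj b b' →
    ∀ (hΛ : (meshDomain (dom C δ) δ).Finite) (z₀ : ℂ) (r R : ℝ) (H : Finset (Site 2)),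
      δ ≤ r → M * r ≤ R → IsCollaredOff hΛ.toFinset a b δ z₀ r R H →
      0 < dirichletGreen hΛ.toFinset a b ∧
        η * dirichletGreen hΛ.toFinset a b ≤ dirichletGreen (hΛ.toFinset \ H) a b

/-- **Killed-walk collar bound on hole-free lattice domains** (reshape r6, worker W4's isolation of the RW content of
`RWCollarBound`): the same collar clauses, but for an ARBITRARY finite hole-free `Λ` (no r2 presentation, no boundary
adjacency of `a, b`), conclusion `η G_Λ(a,b) ≤ G_{Λ∖H}(a,b)`.  Kemppainen–Smirnov 2017 Prop. 4.11 / Thm. 4.12 (RW content) with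
their §2.2 quad→annulus conversion, transplanted to round collars; the printed proof needs Chelkak 2016 Prop. 3.3 (RW bridge
hits a balanced ball; via Prop. 3.1 / Lemma 3.2 / weak Beurling / Harnack), not in tree.  Worker W4 CERTIFIED numerically that the
naive single-threshold "mouth Harnack" intermediate is FALSE on a legal hole-free two-channel collar while the ratio stays at
.9958/.9992/.9998 (R/r = 2/3/4), and that detaching the separating ray (floating T-wall, all other clauses hold) drops the ratio to
4e-11: hole-freeness is essential and any proof must localise per far component. -/
def KilledWalkCollarBound : Prop :=
  ∃ (M η : ℝ), 1 < M ∧ 0 < η ∧ ∀ (δ : ℝ) (Λ : Finset (Site 2)) (a b : Site 2), 0 < δ →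
    HoleFree (↑Λ : Set (Site 2)) →
    ∀ (z₀ : ℂ) (r R : ℝ) (H : Finset (Site 2)), δ ≤ r → M * r ≤ R →
      (∃ V : Finset (Site 2), V ⊆ Λ ∧
        (∀ x ∈ V, r ≤ dist (meshPoint δ x) z₀ ∧ dist (meshPoint δ x) z₀ ≤ R) ∧
        (∃ p : (zdGraph 2).Walk a b, ∀ x ∈ p.support, x ∈ Λ ∧ x ∉ V) ∧
        (∀ y, (∃ p : (zdGraph 2).Walk a y, ∀ x ∈ p.support, x ∈ Λ ∧ x ∉ V) → y ∉ H) ∧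
        (∀ x ∈ V, x ∉ H) ∧
        (∃ p : Site 2, p ∉ Λ ∧ dist (meshPoint δ p) z₀ ≤ r + δ) ∧
        ((∀ x ∈ V, ∀ y ∈ Λ, y ∉ V → (zdGraph 2).Adj x y →
            ((∃ p : (zdGraph 2).Walk a y, ∀ x ∈ p.support, x ∈ Λ ∧ x ∉ V) →
              dist (meshPoint δ y) z₀ < r) ∧
            ((∃ h ∈ H, (∃ p : (zdGraph 2).Walk y h, ∀ x ∈ p.support, x ∈ Λ ∧ x ∉ V)) →
              R < dist (meshPoint δ y) z₀)) ∨
         (∀ x ∈ V, ∀ y ∈ Λ, y ∉ V → (zdGraph 2).Adj x y →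
            ((∃ p : (zdGraph 2).Walk a y, ∀ x ∈ p.support, x ∈ Λ ∧ x ∉ V) →
              R < dist (meshPoint δ y) z₀) ∧
            ((∃ h ∈ H, (∃ p : (zdGraph 2).Walk y h, ∀ x ∈ p.support, x ∈ Λ ∧ x ∉ V)) →
              dist (meshPoint δ y) z₀ < r)))) →
      η * dirichletGreen Λ a b ≤ dirichletGreen (Λ \ H) a b

/-- **SAW collar bound** (the uniform pocket lemma, DERIVED below from ED and the random-walk collar
bound): there are `M > 1`, `η > 0` such that in every r2 domain the critical chord avoids every ONE-SIDED
set `H` collared off by an annulus of modulus `M` (`δ ≤ r`, `M r ≤ R`) with probability `≥ η`: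
`η · Z_Ω(a,b) ≤ Z_{Ω, avoid H}(a,b)`.  Uniform in the domain, the past (any presented slit domain is an
r2 domain) and the mesh. -/
def SAWCollarBound : Prop :=
  ∃ (M η : ℝ), 1 < M ∧ 0 < η ∧ ∀ (δ : ℝ) (c a b a' b' : Site 2) (C : (zdGraph 2).Walk c c),
    0 < δ → a' ∈ C.support → b' ∈ C.support → (zdGraph 2).Adj a a' → (zdGraph 2).Adj b b' →
    ∀ (hΛ : (meshDomain (dom C δ) δ).Finite) (z₀ : ℂ) (r R : ℝ) (H : Finset (Site 2)),
      δ ≤ r → M * r ≤ R → IsCollaredOff hΛ.toFinset a b δ z₀ r R H →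
      OneSided (lrLE (Ω := dom C δ) (δ := δ) (a := a) (b := b))
        (Avoid (H : Set (Site 2)) : Set (DomainSAW (dom C δ) δ a b)) →
      ENNReal.ofReal η * weight (dom C δ) δ a b Set.univ ≤
        weight (dom C δ) δ a b (Avoid (H : Set (Site 2)))

/-- **Collared domination** (lead's reshape r3 — the only form of the card's "compare the chord with the killed
walk" that survives its own falsifier).  HISTORY: the power law `P_SAW(avoid H) ≥ P_RW(avoid H)^C` (card) fails on
ONE width-13 dead-end corridor (strip transfer matrix: the x_c-polymer's penetration rate per row is BELOW the
killed walk's two-way Dirichlet rate from w = 13 on — a positive extrapolation length of 0.022 sites); the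
qualitative form "P_RW(avoid H) ≥ η ⇒ P_SAW(avoid H) ≥ η'(η) for every one-sided finite H" (reshape r1) fails on
`K ≈ ln 2 / q_RW(ℓ)` such corridors hung side by side off one arc (both sides are exact multiplicative cocycles, so
`P_RW(avoid) → 1/2` while `P_SAW(avoid) ≈ 2^{-q_SAW(ℓ)/q_RW(ℓ)} → 0` as ℓ → ∞).  Behind ONE collar of modulus `M`
only `O(r/δ)` corridors of length `≥ (M-1) r` fit, and their total hitting mass vanishes; so the domination is
asserted only for COLLARED one-sided dead ends, i.e. as the implication `RWCollarBound → SAWCollarBound`: the killed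
walk fixes the scale `(M, η)` at which dead ends are rarely explored, and the claim is that the critical chord then
avoids the same dead ends with probability `≥ η' > 0`, uniformly in the rough domain.  Open (it is the uniform
pocket lemma every line of this crux needs, with its ε-scale set by harmonic measure). -/
def CollaredDomination : Prop :=
  RWCollarBound → SAWCollarBound

/-- **Per-shell tightness of the traversal counts** for the shells of modulus `≥ M` (triage X2: this
is all that (H1) with a shell-dependent threshold asks): one `δ₀ > 0` for the endpoint approximation,
and for every shell `D(x; ρ, R)` with `M ρ ≤ R ≤ 1` and every `ε > 0` a threshold `n` with
`P_δ(n separate traversals of D(x; ρ, R)) ≤ ε` for all meshes `δ ≤ δ₀` with `δ ≤ ρ`.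
(`n` may absorb any `δ`-uniform forced count; no rate in `ρ/R`, no uniformity across shells.) -/
def ShellTight (M : ℝ) (D : DobrushinDomain) (a b : ℝ → Site 2) : Prop :=
  ∃ δ₀ : ℝ, 0 < δ₀ ∧ ∀ (x : ℂ) (ρ R : ℝ), 0 < ρ → M * ρ ≤ R → R ≤ 1 → ∀ ε : ℝ, 0 < ε → ∃ n : ℕ,
    ∀ δ ∈ Set.Ioc (0 : ℝ) δ₀, δ ≤ ρ →
      law D.carrier δ (a δ) (b δ)
          {γ | (⟨γ.walk.toCurve (meshPoint δ)⟩ : Curve ℂ).HasTraversals n x ρ R} ≤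
        ENNReal.ofReal ε

/-- **Per-shell tightness on a class of MESHES** (lead's reshape r2, after the stub-5 worker's certified
finding that an approximation-wise split `GoodApprox / ¬GoodApprox` is splice-saturated: `¬GoodApprox` is a
germ-negativity condition, so the residual stub as first typed swallowed every approximation of the disc).  Same
as `ShellTight` but the bound is only asserted at the meshes `δ` satisfying `P δ`; two complementary classes glue
back to `ShellTight` with `δ₀ := min`, `n := max` (`shellTight_of_on`). -/
def ShellTightOn (P : ℝ → Prop) (M : ℝ) (D : DobrushinDomain) (a b : ℝ → Site 2) : Prop :=
  ∃ δ₀ : ℝ, 0 < δ₀ ∧ ∀ (x : ℂ) (ρ R : ℝ), 0 < ρ → M * ρ ≤ R → R ≤ 1 → ∀ ε : ℝ, 0 < ε → ∃ n : ℕ,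
    ∀ δ ∈ Set.Ioc (0 : ℝ) δ₀, δ ≤ ρ → P δ →
      law D.carrier δ (a δ) (b δ)
          {γ | (⟨γ.walk.toCurve (meshPoint δ)⟩ : Curve ℂ).HasTraversals n x ρ R} ≤
        ENNReal.ofReal ε

/-- The lattice domain `D_δ` with endpoints `u, v` is **presentable** as an instance of `LeftRightFKG`:
some closed lattice walk `C` has `discreteDomainGraph (dom C δ) δ = discreteDomainGraph D.carrier δ`
(same sites in the largest component, same edges — r2 domains are induced subgraphs, Disproof F3(c)),
and `u, v` are lattice-adjacent to vertices of `C` (Disproof F3(a): BOTH endpoints boundary-adjacent; a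
presentable endpoint that is a vertex of `Ω_δ` is a `meshBoundary` vertex).  For smooth `D` at small mesh this
is the class R1 (`u, v ∈ meshBoundary`): take for `C` the outer vertex contour of `D_δ`. -/
def Presentable (D : DobrushinDomain) (δ : ℝ) (u v : Site 2) : Prop :=
  ∃ (c u' v' : Site 2) (C : (zdGraph 2).Walk c c), u' ∈ C.support ∧ v' ∈ C.support ∧
    (zdGraph 2).Adj u u' ∧ (zdGraph 2).Adj v v' ∧
    discreteDomainGraph D.carrier δ = discreteDomainGraph (dom C δ) δ

/-- Output of the iteration: per-shell tightness at some modulus `M > 1`, for every endpoint approximation, AT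
THE PRESENTABLE MESHES (where the exploration stays inside the r2 class and `SAWCollarBound` has instances). -/
def GoodShellTight : Prop :=
  ∃ M : ℝ, 1 < M ∧ ∀ (D : DobrushinDomain) (a b : ℝ → Site 2),
    IsEndpointApprox D a b → ShellTightOn (fun δ => Presentable D δ (a δ) (b δ)) M D a b

/-- The residual fragment: per-shell tightness (every modulus `M > 1`) AT THE NON-PRESENTABLE MESHES — deep
endpoints (`exists_isEndpointApprox_deepStart`: non-presentable at every `δ ≤ 1/16`), rough (non-induced)
discretisations.  For an approximation presentable at all small meshes it is vacuous. -/
def ResidualShellTight : Prop :=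
  ∀ M : ℝ, 1 < M → ∀ (D : DobrushinDomain) (a b : ℝ → Site 2),
    IsEndpointApprox D a b → ShellTightOn (fun δ => ¬ Presentable D δ (a δ) (b δ)) M D a b

/-! ## Plumbing statements of the Kemppainen–Smirnov iteration (lead c1, reshape r5)

Three def-free, worker-sized pieces carved out of STUB 4 at the skeleton level.  They are the parts of the
iteration that do not depend on the engine and survive the route repair R1 verbatim. -/

/-- **Tree tail bound** (KS17 Prop. 3.5, "apply Condition G2 `(n−n₀)/2` times", made ADAPTED).  Abstract
finite setting: chords `γ ∈ Γ` with weights `w γ ≥ 0`; `L γ` observation times (ends of middle-annulus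
crossings); `up γ i` = the `i`-th observed crossing (`1 ≤ i ≤ L γ`) is of the costly (index-increasing) kind;
`past γ l` = the label of the past of `γ` at its `l`-th observation time (`l ≤ L γ`).  Hypotheses: ADAPTEDNESS —
chords with the same past at level `l` have the same first `l` marks and both reach level `l`; CONDITIONAL
BOUND — inside every past-class at level `l`, the chords whose `(l+1)`-st crossing exists and is costly weigh at
most `p₀` times the class; COUNTING — along every chord the non-costly crossings never outnumber the costly ones
by more than `n₀` (non-negativity of the KS index started at `≤ n₀`).  Conclusion: the chords with at least
`n₀ + 2m` observed crossings weigh at most `(4p₀)^m 2^{n₀}` times the total (iterate the conditional bound over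
the `≤ 2^{n₀+2m}` sets of `m` costly positions among the first `n₀ + 2m`). -/
def TreeTailBound : Prop :=
  ∀ {ι κ : Type} [DecidableEq κ] (Γ : Finset ι) (w : ι → ℝ) (L : ι → ℕ) (up : ι → ℕ → Bool)
    (past : ι → ℕ → κ) (p₀ : ℝ) (n₀ : ℕ),
    (∀ γ, 0 ≤ w γ) → 0 ≤ p₀ →
    (∀ γ ∈ Γ, ∀ γ' ∈ Γ, ∀ l : ℕ, l ≤ L γ → past γ l = past γ' l →
      l ≤ L γ' ∧ ∀ i, i ≤ l → up γ i = up γ' i) →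
    (∀ γ₀ ∈ Γ, ∀ l : ℕ, l ≤ L γ₀ →
      ∑ γ ∈ Γ with (past γ l = past γ₀ l ∧ l + 1 ≤ L γ ∧ up γ (l + 1) = true), w γ ≤
        p₀ * ∑ γ ∈ Γ with past γ l = past γ₀ l, w γ) →
    (∀ γ ∈ Γ, ∀ l : ℕ, l ≤ L γ →
      ((Finset.Icc 1 l).filter (fun i => up γ i = false)).card ≤
        ((Finset.Icc 1 l).filter (fun i => up γ i = true)).card + n₀) →
    ∀ m : ℕ, ∑ γ ∈ Γ with n₀ + 2 * m ≤ L γ, w γ ≤ (4 * p₀) ^ m * 2 ^ n₀ * ∑ γ ∈ Γ, w γ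

/-- **Sweep lemma** (closure of the r2 boundary class under killing sites): if every site of a finite set `K`
is joined to a vertex of the closed boundary walk `C` by a lattice walk through `K ∪ C.support`, then some
closed walk `C'` from the same base point has vertex set exactly `C.support ∪ K` and the SAME winding number
as `C` about every point off its trace, at every mesh (splice in out-and-back detours `q → k → q`, one new
site at a time; by `LeftRightFKG.Negative.wind_poly_probeL` the winding number at a face centre is minus the
signed probe-crossing count, additive under `append` and odd under `reverse`, and it is locally constant off
the trace).  Consequently `dom C' δ ∩ δℤ² = (dom C δ ∩ δℤ²) ∖ δK` with unchanged indices. -/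
def SweepLemma : Prop :=
  ∀ (c : Site 2) (C : (zdGraph 2).Walk c c) (K : Finset (Site 2)),
    (∀ k ∈ K, ∃ (q : Site 2) (p : (zdGraph 2).Walk k q), q ∈ C.support ∧
      ∀ x ∈ p.support, x ∈ K ∨ x ∈ C.support) →
    ∃ C' : (zdGraph 2).Walk c c,
      (∀ x : Site 2, x ∈ C'.support ↔ (x ∈ C.support ∨ x ∈ K)) ∧
      ∀ (δ : ℝ) (z : ℂ), 0 < δ → z ∉ Set.range (C'.toCurve (meshPoint δ)) →
        z ∉ Set.range (C.toCurve (meshPoint δ)) ∧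
        Literature.Topology.PlaneTopology.wind
            (fun s : ℝ => Set.IccExtend zero_le_one (C'.toCurve (meshPoint δ)) s - z) =
          Literature.Topology.PlaneTopology.wind
            (fun s : ℝ => Set.IccExtend zero_le_one (C.toCurve (meshPoint δ)) s - z)

/-- **Slit presentation** (the r2 class is closed under conditioning on a self-avoiding prefix from a
boundary-adjacent start — the graph-level input `hadj` of the landed domain Markov identity
`Theorems.…ExcursionDomination.weight_prefix_restrict`, p85820).  For a boundary walk `C`, mesh `δ > 0`, a start
`a ∼ a' ∈ C.support`, a self-avoiding prefix `π : a → t` of `Ω_δ = discreteDomainGraph (dom C δ) δ` with `t ≠ a`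
and at least one future to `b` off `π ∖ {t}`: some closed walk `C'` through all vertices of `C` and all of
`π ∖ {t}` presents the slit domain — its graph is `Ω_δ` restricted to `Keep`, the sites joined to `b` off
`π ∖ {t}` (so the tip `t` is adjacent to the vertex of `C'` preceding it on `π`, `b` stays adjacent to `C'`, and
sealed pockets, dropped components and the LARGEST-COMPONENT convention of `meshDomain` are all absorbed: every
old mesh vertex outside `Keep` is swept onto the trace, `SweepLemma`). -/
def SlitPresentation : Prop :=
  ∀ (δ : ℝ) (c a a' t b : Site 2) (C : (zdGraph 2).Walk c c)
    (π : (discreteDomainGraph (dom C δ) δ).Walk a t),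
    0 < δ → a' ∈ C.support → (zdGraph 2).Adj a a' → π.IsPath → a ≠ t →
    (∃ q : (discreteDomainGraph (dom C δ) δ).Walk t b, ∀ x ∈ q.support, x ∈ π.support → x = t) →
    ∃ (c' : Site 2) (C' : (zdGraph 2).Walk c' c'),
      (∀ x ∈ C.support, x ∈ C'.support) ∧ (∀ v ∈ π.support, v ≠ t → v ∈ C'.support) ∧
      ∀ x y : Site 2, (discreteDomainGraph (dom C' δ) δ).Adj x y ↔
        ((discreteDomainGraph (dom C δ) δ).Adj x y ∧
          (∃ q : (discreteDomainGraph (dom C δ) δ).Walk x b, ∀ v ∈ q.support, v ∈ π.support → v = t) ∧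
          (∃ q : (discreteDomainGraph (dom C δ) δ).Walk y b, ∀ v ∈ q.support, v ∈ π.support → v = t))

/-! ## Stubs (registered; `sorry` only here) -/

/-- STUB 1 (HARDEST; open; the lead's) — **left–right PA ⇒ collared domination** (`RWCollarBound → SAWCollarBound`).
Intended route (card step (3), restricted to what the falsifiers leave standing): CARVE/sandwich monotonicities from
`LeftRightFKG` (triage X3) reduce to skeletal domains (opposite arc collapsed to a collar corridor; bead
factorisation), where the claim is a two-leg penetration bound for the critical chord into ONE rough pocket behind a
collar of modulus `M` — the scale `M` being the one at which the killed walk already avoids the pocket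
(`RWCollarBound`).  A PA-free proof also closes the stub (`mono_hyp`).  Cheapest falsifier: one collared one-sided
dead end (modulus ≥ M₀ for every M₀) that the x_c-chord explores with probability → 1 while the walk does not — none
known; the corridor families (one corridor: power law dies; K corridors: qualitative ∀H form dies) do not fit behind
one collar. -/
theorem stub_sawDomination : LeftRightFKG → CollaredDomination := by
  sorry

/-- STUB 2 — **LANDED** (worker, p84645, `Theorems/SAWLeftRightFKGFKGToTraversalBoundGreenDecomposition.lean`, commit
53d17c39; general-`d` version `dirichletGreen_eq_sdiff_add_sum` + `dirichletGreen_sdiff_le/_nonneg` there).  (M; classical; stated DEF-FREE = the body of `GreenDecomposition`, so that the stub file is a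
pure proof over tree names) — **first-entrance decomposition of the Dirichlet Green function.**
`green_representation` with `d = 2` (`Nat.succ_pos 1`) on `Λ ∖ H` for `F := fun x => dirichletGreen Λ x b`;
rewrite `F = dirichletGreen Λ b ·` by `dirichletGreen_comm`, use `neg_latticeLaplacianZd_dirichletGreen` on
`Λ ⊇ Λ ∖ H` to collapse the volume sum to `G_{Λ∖H}(a,b)` (or to `0` when `b ∉ Λ ∖ H`, where `G_{Λ∖H}(a,b) = 0`
too), and identify the boundary sum: `z ∈ outerBoundary (Λ ∖ H)` contributes only if `z ∈ Λ` (else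
`G_Λ(z,b) = 0`), i.e. `z ∈ H`; conversely `z ∈ H` not adjacent to `Λ ∖ H` has `poissonKernel (Λ ∖ H) a z = 0`.
Case `a ∉ Λ ∖ H` (then `a ∉ Λ`): every term is `0`. -/
theorem stub_greenDecomposition :
    ∀ (Λ H : Finset (Site 2)) (a b : Site 2), a ∉ H →
      dirichletGreen Λ a b = dirichletGreen (Λ \ H) a b +
        ∑ z ∈ H, poissonKernel (Λ \ H) a z * dirichletGreen Λ z b :=
  -- LANDED (p84645), wired (lead c1).
  Summit.CriticalPhenomena.SAWScalingLimit.Theorems.FKGToTraversalBound.ExcursionDomination.stub_greenDecomposition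

/-- STUB 3a′ (reshape r8, lead c2) — **the Kemppainen–Smirnov random-walk dead-end bound** (KS17 Thm 4.12 proof +
Prop. 4.11 + the quad-to-annulus summation of Prop. 2.5; RW form of Condition G2, site form on hole-free subsets of ℤ²):
a NAMED PUBLISHED FACT, landed as the Literature definition `Literature.Probability.LatticeModels.KemppainenSmirnov2017_rwDeadEndBound`
(p113449, `Literature/Probability/LatticeModels/KemppainenSmirnovDeadEndBound.lean`; statement only — its printed proof needs
Chelkak 2016 Prop. 3.3 and the discrete extremal length of lattice quads, neither in tree).  This `sorry` is a Literature
DEBT (`theorem KemppainenSmirnov2017_rwDeadEndBound_holds`), not line mathematics; the harness's debt queue owns it. -/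
theorem stub_ksDeadEndBound : KemppainenSmirnov2017_rwDeadEndBound := by
  sorry

/-- STUB 3a (the RW kernel; stated DEF-FREE = the body of `KilledWalkCollarBound`; reshape r6) — **killed-walk collar
bound on hole-free lattice domains** — CLOSED MODULO THE NAMED FACT `KemppainenSmirnov2017_rwDeadEndBound` (reshape r8,
lead c2's worker, 2026-08-16): `KilledWalkCollar.stub_killedWalkCollarBound_of_KS` (p114323,
`Theorems/SAWLeftRightFKGFKGToTraversalBoundKilledWalkCollarBoundOfKS.lean`) with its landed parts p109398 (`…KilledWalkCollarWall`:
mesh-form Beurling near the wall, `stub_killedWalkWallBeurling`), p111883 (`…KilledWalkCollarPassage`: in a hole-free `Λ` the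
collar clauses yield an unforced passage, `stub_killedWalkUnforcedPassage`), p112619 (`…KilledWalkCollarDetour`: the diagonal
case `G_{Λ∖H}(b,b) ≥ ½ G_Λ(b,b)` and the far-detour bound `≤ C_B (12/(M−2))^{β_B} G_Λ(b,b)`, `stub_killedWalkFarDetour`),
p113575 (`…KilledWalkCollarBound`: the stub verbatim under the KS bound spelled out, `stub_killedWalkCollarBound_of_deadEndBound`).
Worker's certified negative (for the disprover and any consult): the "natural" intermediate
`P_a(τ_Y<ζ)·max_Y P_y(τ_b<ζ) ≤ (1−η) P_a(τ_b<ζ)` and every global-max mouth Harnack are FALSE (two walled channels to two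
distinct far components, `a, b` at the two mouths joined inside by a thin corridor of `L` sites: LHS ~ M^{-2c}, RHS ~ e^{-cL}),
so the input is isolated at KS17's G2 level (all dead ends at once). -/
theorem stub_killedWalkCollarBound :
  ∃ (M η : ℝ), 1 < M ∧ 0 < η ∧ ∀ (δ : ℝ) (Λ : Finset (Site 2)) (a b : Site 2), 0 < δ →
    HoleFree (↑Λ : Set (Site 2)) →
    ∀ (z₀ : ℂ) (r R : ℝ) (H : Finset (Site 2)), δ ≤ r → M * r ≤ R →
      (∃ V : Finset (Site 2), V ⊆ Λ ∧
        (∀ x ∈ V, r ≤ dist (meshPoint δ x) z₀ ∧ dist (meshPoint δ x) z₀ ≤ R) ∧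
        (∃ p : (zdGraph 2).Walk a b, ∀ x ∈ p.support, x ∈ Λ ∧ x ∉ V) ∧
        (∀ y, (∃ p : (zdGraph 2).Walk a y, ∀ x ∈ p.support, x ∈ Λ ∧ x ∉ V) → y ∉ H) ∧
        (∀ x ∈ V, x ∉ H) ∧
        (∃ p : Site 2, p ∉ Λ ∧ dist (meshPoint δ p) z₀ ≤ r + δ) ∧
        ((∀ x ∈ V, ∀ y ∈ Λ, y ∉ V → (zdGraph 2).Adj x y →
            ((∃ p : (zdGraph 2).Walk a y, ∀ x ∈ p.support, x ∈ Λ ∧ x ∉ V) →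
              dist (meshPoint δ y) z₀ < r) ∧
            ((∃ h ∈ H, (∃ p : (zdGraph 2).Walk y h, ∀ x ∈ p.support, x ∈ Λ ∧ x ∉ V)) →
              R < dist (meshPoint δ y) z₀)) ∨
         (∀ x ∈ V, ∀ y ∈ Λ, y ∉ V → (zdGraph 2).Adj x y →
            ((∃ p : (zdGraph 2).Walk a y, ∀ x ∈ p.support, x ∈ Λ ∧ x ∉ V) →
              R < dist (meshPoint δ y) z₀) ∧
            ((∃ h ∈ H, (∃ p : (zdGraph 2).Walk y h, ∀ x ∈ p.support, x ∈ Λ ∧ x ∉ V)) →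
              dist (meshPoint δ y) z₀ < r)))) →
      η * dirichletGreen Λ a b ≤ dirichletGreen (Λ \ H) a b :=
  Summit.CriticalPhenomena.SAWScalingLimit.Theorems.FKGToTraversalBound.ExcursionDomination.KilledWalkCollar.stub_killedWalkCollarBound_of_KS
    stub_ksDeadEndBound

/-- STUB 3b (M; provable now — worker W4's reduction, reshape r6; stated DEF-FREE: body of `KilledWalkCollarBound` → the r5
signature of `stub_rwCollarBound`) — **the registered collar bound from the killed-walk kernel**: the lattice domain
`meshDomain (dom C δ) δ` of an r2 domain is HOLE-FREE (`holeFree_meshDomain_dom`: walk north — the index is constant along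
unit segments missing the trace, a lattice point of the trace is a vertex of `C`, adjacent off-trace domain sites are joined
in the mesh graph, and vertices of `C` escape east by `Negative.noFloatingHoles`), and `G_Λ(a,b) > 0` since `a` is joined
to `b` in `Λ ∖ V` (`dirichletGreen_pos_of_walk`); the first-entrance decomposition hypothesis is not needed. -/
theorem stub_rwCollarOfKilled :
    (∃ (M η : ℝ), 1 < M ∧ 0 < η ∧ ∀ (δ : ℝ) (Λ : Finset (Site 2)) (a b : Site 2), 0 < δ →
        HoleFree (↑Λ : Set (Site 2)) →
        ∀ (z₀ : ℂ) (r R : ℝ) (H : Finset (Site 2)), δ ≤ r → M * r ≤ R →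
          (∃ V : Finset (Site 2), V ⊆ Λ ∧
            (∀ x ∈ V, r ≤ dist (meshPoint δ x) z₀ ∧ dist (meshPoint δ x) z₀ ≤ R) ∧
            (∃ p : (zdGraph 2).Walk a b, ∀ x ∈ p.support, x ∈ Λ ∧ x ∉ V) ∧
            (∀ y, (∃ p : (zdGraph 2).Walk a y, ∀ x ∈ p.support, x ∈ Λ ∧ x ∉ V) → y ∉ H) ∧
            (∀ x ∈ V, x ∉ H) ∧
            (∃ p : Site 2, p ∉ Λ ∧ dist (meshPoint δ p) z₀ ≤ r + δ) ∧
            ((∀ x ∈ V, ∀ y ∈ Λ, y ∉ V → (zdGraph 2).Adj x y →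
                ((∃ p : (zdGraph 2).Walk a y, ∀ x ∈ p.support, x ∈ Λ ∧ x ∉ V) →
                  dist (meshPoint δ y) z₀ < r) ∧
                ((∃ h ∈ H, (∃ p : (zdGraph 2).Walk y h, ∀ x ∈ p.support, x ∈ Λ ∧ x ∉ V)) →
                  R < dist (meshPoint δ y) z₀)) ∨
             (∀ x ∈ V, ∀ y ∈ Λ, y ∉ V → (zdGraph 2).Adj x y →
                ((∃ p : (zdGraph 2).Walk a y, ∀ x ∈ p.support, x ∈ Λ ∧ x ∉ V) →
                  R < dist (meshPoint δ y) z₀) ∧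
                ((∃ h ∈ H, (∃ p : (zdGraph 2).Walk y h, ∀ x ∈ p.support, x ∈ Λ ∧ x ∉ V)) →
                  dist (meshPoint δ y) z₀ < r)))) →
          η * dirichletGreen Λ a b ≤ dirichletGreen (Λ \ H) a b) →
    (∀ (Λ H : Finset (Site 2)) (a b : Site 2), a ∉ H →
      dirichletGreen Λ a b = dirichletGreen (Λ \ H) a b +
        ∑ z ∈ H, poissonKernel (Λ \ H) a z * dirichletGreen Λ z b) →
    ∃ (M η : ℝ), 1 < M ∧ 0 < η ∧ ∀ (δ : ℝ) (c a b a' b' : Site 2) (C : (zdGraph 2).Walk c c),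
      0 < δ → a' ∈ C.support → b' ∈ C.support → (zdGraph 2).Adj a a' → (zdGraph 2).Adj b b' →
      ∀ (hΛ : (meshDomain (dom C δ) δ).Finite) (z₀ : ℂ) (r R : ℝ) (H : Finset (Site 2)),
        δ ≤ r → M * r ≤ R →
        (∃ V : Finset (Site 2), V ⊆ hΛ.toFinset ∧
          (∀ x ∈ V, r ≤ dist (meshPoint δ x) z₀ ∧ dist (meshPoint δ x) z₀ ≤ R) ∧
          (∃ p : (zdGraph 2).Walk a b, ∀ x ∈ p.support, x ∈ hΛ.toFinset ∧ x ∉ V) ∧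
          (∀ y, (∃ p : (zdGraph 2).Walk a y, ∀ x ∈ p.support, x ∈ hΛ.toFinset ∧ x ∉ V) → y ∉ H) ∧ (∀ x ∈ V, x ∉ H) ∧
          (∃ p : Site 2, p ∉ hΛ.toFinset ∧ dist (meshPoint δ p) z₀ ≤ r + δ) ∧
          ((∀ x ∈ V, ∀ y ∈ hΛ.toFinset, y ∉ V → (zdGraph 2).Adj x y →
              ((∃ p : (zdGraph 2).Walk a y, ∀ x ∈ p.support, x ∈ hΛ.toFinset ∧ x ∉ V) → dist (meshPoint δ y) z₀ < r) ∧
              ((∃ h ∈ H, (∃ p : (zdGraph 2).Walk y h, ∀ x ∈ p.support, x ∈ hΛ.toFinset ∧ x ∉ V)) → R < dist (meshPoint δ y) z₀)) ∨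
           (∀ x ∈ V, ∀ y ∈ hΛ.toFinset, y ∉ V → (zdGraph 2).Adj x y →
              ((∃ p : (zdGraph 2).Walk a y, ∀ x ∈ p.support, x ∈ hΛ.toFinset ∧ x ∉ V) → R < dist (meshPoint δ y) z₀) ∧
              ((∃ h ∈ H, (∃ p : (zdGraph 2).Walk y h, ∀ x ∈ p.support, x ∈ hΛ.toFinset ∧ x ∉ V)) → dist (meshPoint δ y) z₀ < r)))) →
        0 < dirichletGreen hΛ.toFinset a b ∧
          η * dirichletGreen hΛ.toFinset a b ≤ dirichletGreen (hΛ.toFinset \ H) a b :=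
  -- LANDED: p102608 (worker W4 of lead c1) could not be imported next to `…SlitPresentation` (FQN clash on
  -- `…ExcursionDomination.meshGraph_adj_of_adj`); RE-LANDED by lead c2 under the sub-namespace `…KilledReduction`
  -- (p106714, `Theorems/SAWLeftRightFKGFKGToTraversalBoundRWCollarOfKilled2.lean`, reviewed + accepted) and wired (reshape r7).
  Summit.CriticalPhenomena.SAWScalingLimit.Theorems.FKGToTraversalBound.ExcursionDomination.KilledReduction.stub_rwCollarOfKilled

/-- STUB 3 of reshape r4/r5 reassembled (reshape r6): the def-free hypothesis `GreenDecomposition` is still accepted (and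
ignored by the new route through the killed-walk kernel). -/
theorem stub_rwCollarBound :
    (∀ (Λ H : Finset (Site 2)) (a b : Site 2), a ∉ H →
      dirichletGreen Λ a b = dirichletGreen (Λ \ H) a b +
        ∑ z ∈ H, poissonKernel (Λ \ H) a z * dirichletGreen Λ z b) →
    ∃ (M η : ℝ), 1 < M ∧ 0 < η ∧ ∀ (δ : ℝ) (c a b a' b' : Site 2) (C : (zdGraph 2).Walk c c),
      0 < δ → a' ∈ C.support → b' ∈ C.support → (zdGraph 2).Adj a a' → (zdGraph 2).Adj b b' →
      ∀ (hΛ : (meshDomain (dom C δ) δ).Finite) (z₀ : ℂ) (r R : ℝ) (H : Finset (Site 2)),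
        δ ≤ r → M * r ≤ R →
        (∃ V : Finset (Site 2), V ⊆ hΛ.toFinset ∧
          (∀ x ∈ V, r ≤ dist (meshPoint δ x) z₀ ∧ dist (meshPoint δ x) z₀ ≤ R) ∧
          (∃ p : (zdGraph 2).Walk a b, ∀ x ∈ p.support, x ∈ hΛ.toFinset ∧ x ∉ V) ∧
          (∀ y, (∃ p : (zdGraph 2).Walk a y, ∀ x ∈ p.support, x ∈ hΛ.toFinset ∧ x ∉ V) → y ∉ H) ∧ (∀ x ∈ V, x ∉ H) ∧
          (∃ p : Site 2, p ∉ hΛ.toFinset ∧ dist (meshPoint δ p) z₀ ≤ r + δ) ∧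
          ((∀ x ∈ V, ∀ y ∈ hΛ.toFinset, y ∉ V → (zdGraph 2).Adj x y →
              ((∃ p : (zdGraph 2).Walk a y, ∀ x ∈ p.support, x ∈ hΛ.toFinset ∧ x ∉ V) → dist (meshPoint δ y) z₀ < r) ∧
              ((∃ h ∈ H, (∃ p : (zdGraph 2).Walk y h, ∀ x ∈ p.support, x ∈ hΛ.toFinset ∧ x ∉ V)) → R < dist (meshPoint δ y) z₀)) ∨
           (∀ x ∈ V, ∀ y ∈ hΛ.toFinset, y ∉ V → (zdGraph 2).Adj x y →
              ((∃ p : (zdGraph 2).Walk a y, ∀ x ∈ p.support, x ∈ hΛ.toFinset ∧ x ∉ V) → R < dist (meshPoint δ y) z₀) ∧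
              ((∃ h ∈ H, (∃ p : (zdGraph 2).Walk y h, ∀ x ∈ p.support, x ∈ hΛ.toFinset ∧ x ∉ V)) → dist (meshPoint δ y) z₀ < r)))) →
        0 < dirichletGreen hΛ.toFinset a b ∧
          η * dirichletGreen hΛ.toFinset a b ≤ dirichletGreen (hΛ.toFinset \ H) a b :=
  stub_rwCollarOfKilled stub_killedWalkCollarBound


/-- STUB 4 (XL, charted: the Kemppainen–Smirnov iteration for ONE curve with an exact domain Markov
property, on the lattice) — **SAW collar bound ⇒ per-shell tightness for good approximations.**
Chart: (a) DOMAIN MARKOV: for a prefix `π` of the SAW (a lattice stopping time), the conditional law of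
the future is `SAW.law (dom C') δ tip (b δ)` for the spliced closed walk
`C' = C · (a' → a δ → π minus tip → back)` plus out-and-back detours killing the pockets sealed by `π`
(zero winding added; `noFloatingHoles`; transport of `DomainSAW` along the graph equality of
`Presentable` by `SimpleGraph.Walk.transfer`); (b) ONE-SIDEDNESS: the sites beyond an avoidable
component of `annulus ∩ (D_δ ∖ π)` with monochromatic walls form a dead end attached to ONE arc of
`C'`, hence `Avoid` of it is one-sided in `lrLE` (lattice crosscut lemma, wind API of
`Topology.PlaneTopology.WindingNumber`, Disproof §6) and `IsCollaredOff` holds with `V` = the component's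
sites (union over all such components of one colour); (c) hence, from `SAWCollarBound` with `(M, η)`:
`P(next sub-annulus crossing is unforced | prefix) ≤ 1 − η`; NESTING over `k` concentric collars of
modulus `M` (KS17 p. 11): an unforced crossing of modulus `M^k` costs `≤ (1-η)^k =: p < 1/4`;
(d) KS17 Lemma 3.6 on the lattice (index of the prefix = minimal number of middle-annulus crossings of
its futures, `±1` per crossing, index-increasing crossings contain unforced ones) and the counting of
Prop. 3.5: `P(n₀ + 2m traversals of D(x; ρ, R)) ≤ 4^m p^m` once `R ≥ M^{3k} ρ`, where the forced
count `n₀(x, ρ, R; D, a, b)` is finite and uniform in `δ ≤ δ₀` (a Jordan curve traverses a genuine shell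
finitely often, `Curve.exists_not_hasTraversals`; uniform local connectedness
`JordanDomain.exists_modulus`; template `Percolation.bondExploration_traversalBound_holds`).
COUNTING CAVEAT (budget for it): the observation times `σ_l` (ends of middle-annulus crossings) are
unbounded in number, so "apply the bound `(n−n₀)/2` times" must be written as an adapted argument —
e.g. the supermartingale `λ^{I_l} θ^l` (`λ = 2`, `θ = (2p + 1/2)^{-1} > 1` for `p < 1/4`) on the index
`I_l` at the times `σ_l`, which needs every index-INCREASING next crossing to enter a dead end that is
collared and one-sided at `σ_l` (KS claim 2 after an increase; a re-entry after a decrease is an entry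
into the pocket just left, again avoidable and monochromatic) — then `P(L ≥ n) ≤ λ^{n₀} θ^{-n}` for the
number `L ≥ N` of middle-annulus crossings, which is all per-shell tightness needs.
Output: `ShellTight (M^{3k})` for every good approximation.
RESHAPE r5 (lead c1): the adapted counting is now the separate stub `stub_treeTailBound` (which replaces the
supermartingale by the elementary "choose the `m` costly positions among the first `n₀ + 2m`" iteration), and
the presentation step (a) is the separate stubs `stub_sweep` / `stub_slitPresentation`; this stub keeps
(b)–(d): the lattice geometry (one-sidedness and collar structure of avoidable monochromatic components, the
`δ`-uniform forced count `n₀`, `HasTraversals` of the mesh polyline ↔ lattice crossings) and the assembly. -/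
theorem stub_shellIterationCore :
    TreeTailBound → SlitPresentation → SAWCollarBound → GoodShellTight := by
  sorry

/-- STUB 4a (M; pure finite combinatorics/probability, provable now; stated DEF-FREE = the body of
`TreeTailBound`) — **tree tail bound**: the adapted form of "apply the conditional bound `(n−n₀)/2` times".
Proof chart: (1) for positions `s₁ < ⋯ < s_k`, `W(s) := Σ {γ : s_k ≤ L γ ∧ ∀ j, up γ s_j} w ≤ p₀^k Σ_Γ w`
by induction on `k`: the event for `s₁..s_{k-1}` intersected with `{s_k - 1 ≤ L}` is a UNION OF PAST-CLASSES
at level `s_k - 1` (adaptedness), on each class the conditional bound gives the factor `p₀`, and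
`{s_k - 1 ≤ L} ⊆ {s_{k-1} ≤ L}`; (2) if `n₀ + 2m ≤ L γ` then among the first `n₀ + 2m` marks at least `m` are
costly (counting hypothesis at `l = n₀ + 2m`), so the event is covered by the `≤ 2^{n₀+2m}` events of (1)
with `k = m`. -/
theorem stub_treeTailBound :
    ∀ {ι κ : Type} [DecidableEq κ] (Γ : Finset ι) (w : ι → ℝ) (L : ι → ℕ) (up : ι → ℕ → Bool)
      (past : ι → ℕ → κ) (p₀ : ℝ) (n₀ : ℕ),
      (∀ γ, 0 ≤ w γ) → 0 ≤ p₀ →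
      (∀ γ ∈ Γ, ∀ γ' ∈ Γ, ∀ l : ℕ, l ≤ L γ → past γ l = past γ' l →
        l ≤ L γ' ∧ ∀ i, i ≤ l → up γ i = up γ' i) →
      (∀ γ₀ ∈ Γ, ∀ l : ℕ, l ≤ L γ₀ →
        ∑ γ ∈ Γ with (past γ l = past γ₀ l ∧ l + 1 ≤ L γ ∧ up γ (l + 1) = true), w γ ≤
          p₀ * ∑ γ ∈ Γ with past γ l = past γ₀ l, w γ) →
      (∀ γ ∈ Γ, ∀ l : ℕ, l ≤ L γ →
        ((Finset.Icc 1 l).filter (fun i => up γ i = false)).card ≤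
          ((Finset.Icc 1 l).filter (fun i => up γ i = true)).card + n₀) →
      ∀ m : ℕ, ∑ γ ∈ Γ with n₀ + 2 * m ≤ L γ, w γ ≤ (4 * p₀) ^ m * 2 ^ n₀ * ∑ γ ∈ Γ, w γ :=
  -- LANDED (p99860, worker W1 of lead c1), wired.
  Summit.CriticalPhenomena.SAWScalingLimit.Theorems.FKGToTraversalBound.ExcursionDomination.stub_treeTailBound

/-- STUB 4b (M/L; lattice combinatorics with the tree's combinatorial winding API, provable now; stated
DEF-FREE = the body of `SweepLemma`) — **sweep lemma**.  Induction on `#K`: some `k ∈ K` is lattice-adjacent to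
a vertex `q` of `C` (last `K`-site of a joining walk); splice the detour `q → k → q` into `C` at an occurrence
of `q` (`takeUntil`/`dropUntil`); the support grows by `{k}`; off the new trace the winding number is unchanged:
reduce to mesh `1` by `LeftRightFKGStubMeshReduction.wind_const_mul_sub`, join `z` inside its closed face to the
face centre off the trace (`OrderCharacterisation`, proof of `wind_nonneg_iff_wcross`), and use
`wind_poly_probeL` (= `-pathCross`, additive: `wcross_append`, `wcross_reverse`) /
`wind_poly_probeL_eq_zero_of_not_mem`; the remaining `K ∖ {k}` satisfies the hypothesis for the new walk. -/
theorem stub_sweep :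
    ∀ (c : Site 2) (C : (zdGraph 2).Walk c c) (K : Finset (Site 2)),
      (∀ k ∈ K, ∃ (q : Site 2) (p : (zdGraph 2).Walk k q), q ∈ C.support ∧
        ∀ x ∈ p.support, x ∈ K ∨ x ∈ C.support) →
      ∃ C' : (zdGraph 2).Walk c c,
        (∀ x : Site 2, x ∈ C'.support ↔ (x ∈ C.support ∨ x ∈ K)) ∧
        ∀ (δ : ℝ) (z : ℂ), 0 < δ → z ∉ Set.range (C'.toCurve (meshPoint δ)) →
          z ∉ Set.range (C.toCurve (meshPoint δ)) ∧
          Literature.Topology.PlaneTopology.wind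
              (fun s : ℝ => Set.IccExtend zero_le_one (C'.toCurve (meshPoint δ)) s - z) =
            Literature.Topology.PlaneTopology.wind
              (fun s : ℝ => Set.IccExtend zero_le_one (C.toCurve (meshPoint δ)) s - z) :=
  -- LANDED (p100023, worker W2 of lead c1), wired.
  Summit.CriticalPhenomena.SAWScalingLimit.Theorems.FKGToTraversalBound.ExcursionDomination.stub_sweep

/-- STUB 4c (L; discretisation plumbing, provable now; stated DEF-FREE: `SweepLemma → SlitPresentation` with
both bodies written out) — **slit presentation from the sweep lemma**.  Chart: let
`Keep := {v | some walk v → b of Ω_δ meets π only at t}` and sweep `K := (meshVertices (dom C δ) δ) ∖ Keep`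
(finite: `dom` is bounded, `LeftRightFKGDefs.isBounded_dom`, `meshVertices_finite`); every site of `K` is joined
to `C.support` through `K ∪ C.support` (a site of `π ∖ {t}` along `π` back to `a ∼ a'`; a sealed pocket or a
dropped / non-maximal cluster through its outer vertex boundary, which lies on the trace of `C` or in
`π ∖ {t}` — `Negative.noFloatingHoles`-style bookkeeping).  For the swept walk `C'`: a lattice site is a mesh
vertex of `dom C' δ` iff it is in `Keep` (sites: `notMem_dom_of_mem_support`; indices unchanged off the trace);
two adjacent `Keep` sites span an off-trace segment (`LoopWindVanish.disjoint_segment_of_not_mem`), which lies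
in `dom C' δ ⊆ closure`, so `Keep` is ONE component of the new mesh-vertex graph, hence `meshDomain`, with
induced edges; conversely an edge of the new graph has both ends in `Keep` and is an old edge. -/
theorem stub_slitPresentation :
    (∀ (c : Site 2) (C : (zdGraph 2).Walk c c) (K : Finset (Site 2)),
      (∀ k ∈ K, ∃ (q : Site 2) (p : (zdGraph 2).Walk k q), q ∈ C.support ∧
        ∀ x ∈ p.support, x ∈ K ∨ x ∈ C.support) →
      ∃ C' : (zdGraph 2).Walk c c,
        (∀ x : Site 2, x ∈ C'.support ↔ (x ∈ C.support ∨ x ∈ K)) ∧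
        ∀ (δ : ℝ) (z : ℂ), 0 < δ → z ∉ Set.range (C'.toCurve (meshPoint δ)) →
          z ∉ Set.range (C.toCurve (meshPoint δ)) ∧
          Literature.Topology.PlaneTopology.wind
              (fun s : ℝ => Set.IccExtend zero_le_one (C'.toCurve (meshPoint δ)) s - z) =
            Literature.Topology.PlaneTopology.wind
              (fun s : ℝ => Set.IccExtend zero_le_one (C.toCurve (meshPoint δ)) s - z)) →
    ∀ (δ : ℝ) (c a a' t b : Site 2) (C : (zdGraph 2).Walk c c)
      (π : (discreteDomainGraph (dom C δ) δ).Walk a t),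
      0 < δ → a' ∈ C.support → (zdGraph 2).Adj a a' → π.IsPath → a ≠ t →
      (∃ q : (discreteDomainGraph (dom C δ) δ).Walk t b, ∀ x ∈ q.support, x ∈ π.support → x = t) →
      ∃ (c' : Site 2) (C' : (zdGraph 2).Walk c' c'),
        (∀ x ∈ C.support, x ∈ C'.support) ∧ (∀ v ∈ π.support, v ≠ t → v ∈ C'.support) ∧
        ∀ x y : Site 2, (discreteDomainGraph (dom C' δ) δ).Adj x y ↔
          ((discreteDomainGraph (dom C δ) δ).Adj x y ∧
            (∃ q : (discreteDomainGraph (dom C δ) δ).Walk x b, ∀ v ∈ q.support, v ∈ π.support → v = t) ∧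
            (∃ q : (discreteDomainGraph (dom C δ) δ).Walk y b,
              ∀ v ∈ q.support, v ∈ π.support → v = t)) :=
  -- LANDED (p102570, worker W3 of lead c1), wired.
  Summit.CriticalPhenomena.SAWScalingLimit.Theorems.FKGToTraversalBound.ExcursionDomination.stub_slitPresentation

/-- STUB 5 (open; NOT this line's mechanism — the shared residue of every line of this crux, Disproof
F3 / triage X1, S1–S2, P1) — **per-shell tightness at the NON-PRESENTABLE meshes** (reshape r2: mesh-wise split):
deep marked points (`exists_isEndpointApprox_deepStart`: lattice depth `δ^{-1/2}`; there PA has no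
instance, `not_presentable_of_enclosed`, `not_PAClause_of_two_maximal`, and KS-G2 fails for floating
pasts, two-corridor ring `P → .996`) and rough Jordan boundaries whose discretisation drops edges
(F3(c)).  Needs interior return estimates for the critical SAW (whole-plane 3-arm type, F3 upshot) or
the statement repair R1 at route level (restrict `IsEndpointApprox` to `meshBoundary` endpoints + a
deep-endpoint reduction item) — tenure business; recorded here so that the composition is honest. -/
theorem stub_residualShells : ResidualShellTight := by
  sorry

/-! ## Glue (sorry-free) -/

/-- The def-free stubs 2–3 assemble to `RWCollarBound` (definitional unfolding of `GreenDecomposition`,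
`RWCollarBound`, `IsCollaredOff`, `JoinedOff`). -/
theorem rwCollarBound_of_stub : RWCollarBound :=
  stub_rwCollarBound stub_greenDecomposition

/-- **Collared domination + random-walk collar bound ⇒ SAW collar bound** (now a one-line application; kept as
the named joint of the composition). -/
theorem sawCollarBound_of (hCD : CollaredDomination) (hRW : RWCollarBound) : SAWCollarBound :=
  hCD hRW

/-- The def-free stub 4a is `TreeTailBound` (definitional). -/
theorem treeTailBound_of_stub : TreeTailBound :=
  fun Γ w L up past p₀ n₀ => stub_treeTailBound Γ w L up past p₀ n₀

/-- The def-free stub 4b is `SweepLemma` (definitional). -/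
theorem sweepLemma_of_stub : SweepLemma :=
  stub_sweep

/-- The def-free stubs 4b–4c assemble to `SlitPresentation` (definitional). -/
theorem slitPresentation_of_stub : SlitPresentation :=
  stub_slitPresentation stub_sweep

/-- STUB 4 of reshape r4 reassembled: the three plumbing stubs and the geometric core give the iteration. -/
theorem shellIteration_of_stubs : SAWCollarBound → GoodShellTight :=
  stub_shellIterationCore treeTailBound_of_stub slitPresentation_of_stub

/-- **Mesh-wise glue**: per-shell tightness on a class of meshes and on its complement give per-shell
tightness (`δ₀ := min`, `n := max`, `HasTraversals.of_le`). -/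
theorem shellTight_of_on {P : ℝ → Prop} {M : ℝ} {D : DobrushinDomain} {a b : ℝ → Site 2}
    (h₁ : ShellTightOn P M D a b) (h₂ : ShellTightOn (fun δ => ¬ P δ) M D a b) : ShellTight M D a b := by
  classical
  obtain ⟨δ₁, hδ₁, H₁⟩ := h₁
  obtain ⟨δ₂, hδ₂, H₂⟩ := h₂
  refine ⟨min δ₁ δ₂, lt_min hδ₁ hδ₂, ?_⟩
  intro x ρ R hρ hMR hR1 ε hε
  obtain ⟨n₁, hn₁⟩ := H₁ x ρ R hρ hMR hR1 ε hε
  obtain ⟨n₂, hn₂⟩ := H₂ x ρ R hρ hMR hR1 ε hε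
  refine ⟨max n₁ n₂, ?_⟩
  intro δ hδ hδρ
  have hδ1 : δ ∈ Set.Ioc (0 : ℝ) δ₁ := ⟨hδ.1, hδ.2.trans (min_le_left _ _)⟩
  have hδ2 : δ ∈ Set.Ioc (0 : ℝ) δ₂ := ⟨hδ.1, hδ.2.trans (min_le_right _ _)⟩
  by_cases hP : P δ
  · refine le_trans (measure_mono ?_) (hn₁ δ hδ1 hδρ hP)
    intro γ hγ
    exact Curve.HasTraversals.of_le hγ (le_max_left _ _)
  · refine le_trans (measure_mono ?_) (hn₂ δ hδ2 hδρ hP)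
    intro γ hγ
    exact Curve.HasTraversals.of_le hγ (le_max_right _ _)

/-- Whatever the junk conventions, the SAW law gives mass at most `1` to every event. -/
theorem law_le_one (Ω : Set ℂ) (δ : ℝ) (u v : Site 2) (S : Set (DomainSAW Ω δ u v)) :
    law Ω δ u v S ≤ 1 := by
  calc law Ω δ u v S ≤ law Ω δ u v Set.univ := measure_mono (Set.subset_univ _)
    _ = (weight Ω δ u v Set.univ)⁻¹ * weight Ω δ u v Set.univ := by
        rw [law, Measure.smul_apply, smul_eq_mul]
    _ ≤ 1 := ENNReal.inv_mul_le_one _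

/-- The target probability `M³ (ρ/R)³` of a shell of modulus `≥ M` is positive. -/
theorem eps_pos {M ρ R : ℝ} (hM : 1 < M) (hρ : 0 < ρ) (h : M * ρ ≤ R) :
    0 < M ^ 3 * (ρ / R) ^ 3 := by
  have hM0 : 0 < M := by linarith
  have hR : 0 < R := lt_of_lt_of_le (by positivity) h
  positivity

/-- Real power with exponent `3` is the monomial. -/
theorem rpow_three (t : ℝ) : t ^ (3 : ℝ) = t ^ (3 : ℕ) := by
  rw [← Real.rpow_natCast]; norm_num

/-- **Per-shell tightness ⇒ (H1)** (triage X2, proved): with `K = M³`, `λ = 3` and the threshold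
`k(x, ρ, R) :=` the `M³(ρ/R)³`-quantile of the traversal count when `M ρ ≤ R ≤ 1` (and `0` otherwise,
where `K (ρ/R)³ > 1 ≥ law` is free), per-shell tightness at modulus `M` gives `SAWTraversalBound`. -/
theorem traversalBound_of_shellTight {M : ℝ} (hM : 1 < M)
    (h : ∀ (D : DobrushinDomain) (a b : ℝ → Site 2), IsEndpointApprox D a b → ShellTight M D a b) :
    SAWTraversalBound := by
  classical
  intro D a b hab
  obtain ⟨δ₀, hδ₀, H⟩ := h D a b hab
  have hM0 : 0 < M := by linarith
  choose n hn using H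
  set k : ℂ → ℝ → ℝ → ℕ := fun x ρ R =>
    if hc : 0 < ρ ∧ M * ρ ≤ R ∧ R ≤ 1 then
      n x ρ R hc.1 hc.2.1 hc.2.2 (M ^ 3 * (ρ / R) ^ 3) (eps_pos hM hc.1 hc.2.1)
    else 0 with hk
  refine ⟨k, M ^ 3, 3, δ₀, by positivity, by norm_num, hδ₀, ?_⟩
  intro δ hδ x ρ R hδρ hρR hR1
  have hρ : 0 < ρ := hδ.1.trans_le hδρ
  have hR : 0 < R := hρ.trans hρR
  rw [rpow_three]
  by_cases hcase : M * ρ ≤ R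
  · have hkx : k x ρ R =
        n x ρ R hρ hcase hR1 (M ^ 3 * (ρ / R) ^ 3) (eps_pos hM hρ hcase) := by
      simp only [hk, dif_pos (And.intro hρ (And.intro hcase hR1))]
    rw [hkx]
    exact hn x ρ R hρ hcase hR1 _ _ δ hδ hδρ
  · have hcase : R < M * ρ := lt_of_not_ge hcase
    have hbig : (1 : ℝ) ≤ M ^ 3 * (ρ / R) ^ 3 := by
      have h1 : 1 < M * (ρ / R) := by
        rw [mul_div_assoc', lt_div_iff₀ hR]
        linarith
      have h2 : (1 : ℝ) ≤ (M * (ρ / R)) ^ 3 := one_le_pow₀ h1.le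
      calc (1 : ℝ) ≤ (M * (ρ / R)) ^ 3 := h2
        _ = M ^ 3 * (ρ / R) ^ 3 := by ring
    calc law D.carrier δ (a δ) (b δ)
          {γ | (⟨γ.walk.toCurve (meshPoint δ)⟩ : Curve ℂ).HasTraversals (k x ρ R) x ρ R}
        ≤ 1 := law_le_one _ _ _ _ _
      _ ≤ ENNReal.ofReal (M ^ 3 * (ρ / R) ^ 3) := ENNReal.one_le_ofReal.2 hbig

/-! ## Composition (sorry-free) -/

/-- **`FKGToTraversalBound` from the stubs.**  PA feeds collared domination (stub 1); the Green
decomposition (stub 2) feeds the random-walk collar bound (stub 3); the proved glue gives the SAW collar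
bound; the Kemppainen–Smirnov iteration (stub 4) turns it into per-shell tightness at some modulus `M` for
every approximation at its presentable meshes, the residual stub 5 supplies the non-presentable meshes at the same
`M` (mesh-wise glue `shellTight_of_on`), and the proved quantile reduction assembles (H1). -/
theorem FKGToTraversalBound_of : FKGToTraversalBound := by
  intro hPA
  obtain ⟨M, hM, hgood⟩ :=
    shellIteration_of_stubs
      (sawCollarBound_of (stub_sawDomination hPA) (rwCollarBound_of_stub))
  exact traversalBound_of_shellTight hM fun D a b hab =>
    shellTight_of_on (hgood D a b hab) (stub_residualShells M hM D a b hab)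

end Summit.CriticalPhenomena.SAWScalingLimit.Cruxes.FKGToTraversalBound.ExcursionDomination

end
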